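import Literature.Analysis.FluidPDE.SverakLandauRadialVorticity
import Literature.Analysis.FluidPDE.SverakLandauPoincare
import HarnessLib

/-!
# Šverák's classification of `(−1)`-homogeneous steady Navier–Stokes flows — the tangential field is a gradient

Analysis/FluidPDE support file of the series `SverakLandau*` proving the named fact
`Literature.Analysis.FluidPDE.Sverak2011_landauClassification` (V. Šverák, J. Math. Sci. 179
(2011) = arXiv:math/0604550, Thm. 1).

Šverák, §4: "Once we know that `dv = 0` … we can write `v = ∇φ` for a suitable smooth function
`φ` on `S²`."  In the `ℝ³ ∖ {0}` rendering: the tangential part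
`V(x) = u(x) − (⟪x, u x⟫/|x|²) x` of the `(−1)`-homogeneous velocity has, by Lemma 1
(`⟪x, curl u⟫ ≡ 0`, `SverakLandauRadialVorticity`) and Euler's relation, a **symmetric
derivative** on `{x ≠ 0}` — in coordinates `|x|²(∂ₗuᵢ − ∂ᵢuₗ) = ∂ₗF xᵢ − ∂ᵢF xₗ`, `F = ⟪x, u⟫`
(`Sverak2011.tangential_algebra`), whence `∂ₗVᵢ = ∂ᵢVₗ` (`Sverak2011.pderiv_tangential_symm_on`,
computed for globally smooth regularisations, with `|x|⁻²` replaced by a smooth `R`, `R|x|² = 1`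
on the relevant open set) — so by the Poincaré lemma of `SverakLandauPoincare` it is a gradient:

* `Sverak2011.exists_tangential_potential` — **there is `Φ`, smooth and `0`-homogeneous on
  `{x ≠ 0}`, with `∇Φ(x) = u(x) − (⟪x, u x⟫/|x|²) x`** (`DΦ(x) = ⟪V(x), ·⟫`), for the data of
  Šverák's Theorem 1.

## References

* V. Šverák, *On Landau's solutions of the Navier–Stokes equations*, J. Math. Sci. 179 (2011)
  208–228, arXiv:math/0604550, §4. [`Sverak2011`]
-/

noncomputable section

open Set Filter Metric
open scoped Topology BigOperators ContDiff Laplacian RealInnerProductSpace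

namespace Literature.Analysis.FluidPDE

namespace Sverak2011

/-! ### Algebra: vanishing radial vorticity makes the tangential gradient symmetric -/

/-- **The tangential algebra.** At a point `x ∈ ℝ³` let `d j i = ∂ⱼuᵢ` satisfy Euler's relation
`∑ⱼ xⱼ∂ⱼuᵢ = −uᵢ` and let the radial vorticity vanish,
`x₀(∂₁u₂ − ∂₂u₁) + x₁(∂₂u₀ − ∂₀u₂) + x₂(∂₀u₁ − ∂₁u₀) = 0`.  Then with `F₁ l = ∂ₗ⟪x, u⟫ = uₗ +
∑ᵢ xᵢ∂ₗuᵢ`: `|x|²(∂ₗuᵢ − ∂ᵢuₗ) = F₁ l xᵢ − F₁ i xₗ` (the antisymmetric part of `∇u` is that of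
`x ⊗ ∇F/|x|²`; Šverák: "`dv = 0`"). [cite: Sverak2011, §4 Lemma 1] -/
theorem tangential_algebra (x u F₁ : Fin 3 → ℝ) (d : Fin 3 → Fin 3 → ℝ) (r2 : ℝ)
    (hEu : ∀ i, ∑ j, x j * d j i = -u i)
    (hq : x 0 * (d 1 2 - d 2 1) + x 1 * (d 2 0 - d 0 2) + x 2 * (d 0 1 - d 1 0) = 0)
    (hr2 : r2 = ∑ i, x i ^ 2) (hF₁ : ∀ l, F₁ l = u l + ∑ i, x i * d l i) (l i : Fin 3) :
    r2 * (d l i - d i l) = F₁ l * x i - F₁ i * x l := by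
  simp only [Fin.sum_univ_three] at hEu hr2 hF₁
  have hu : ∀ i, u i = -(x 0 * d 0 i + x 1 * d 1 i + x 2 * d 2 i) := fun i => by
    linarith [hEu i]
  simp only [hF₁, hu]
  subst hr2
  fin_cases l <;> fin_cases i <;>
    simp only [Fin.zero_eta, Fin.mk_one, Fin.reduceFinMk, Fin.isValue]
  · ring
  · linear_combination (x 2) * hq
  · linear_combination (-(x 1)) * hq
  · linear_combination (-(x 2)) * hq
  · ring
  · linear_combination (x 0) * hq
  · linear_combination (x 1) * hq
  · linear_combination (-(x 0)) * hq
  · ring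

/-! ### The symmetric derivative of the regularised tangential field -/

section Global

variable {U : EuclideanSpace ℝ (Fin 3) → EuclideanSpace ℝ (Fin 3)} {R : EuclideanSpace ℝ (Fin 3) → ℝ}
  {S : Set (EuclideanSpace ℝ (Fin 3))}

/-- Derivative of a smooth `R` with `R |y|² = 1` on the open set `S`: `∂ₗR = −2yₗR²` there. [folklore] -/
theorem pderiv_invNormSq_on (hR : ContDiff ℝ ∞ R) (hS : IsOpen S)
    (hR1 : ∀ y ∈ S, R y * ∑ i, y i ^ 2 = 1) {y : EuclideanSpace ℝ (Fin 3)} (hy : y ∈ S)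
    (l : Fin 3) : pderiv l R y = -2 * y l * R y ^ 2 := by
  have hRd : Differentiable ℝ R := hR.differentiable (by simp)
  have h0 := pderiv_eq_zero_of_eqOn_zero hS (f := fun y => R y * ∑ i, y i ^ 2 - 1)
    (fun z hz => by rw [hR1 z hz, sub_self]) l hy
  rw [pderiv_sub (f := fun y => R y * ∑ i, y i ^ 2) (g := fun _ => (1 : ℝ))
      (hRd.mul differentiable_normSq) (differentiable_const _),
    pderiv_mul hRd differentiable_normSq, pderiv_normSq, pderiv_const] at h0
  simp only [sub_zero] at h0
  have h1 := hR1 y hy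
  -- `∂ₗR · |y|² + R · 2yₗ = 0`, multiply by `R`
  have h2 : pderiv l R y * (R y * ∑ i, y i ^ 2) + 2 * y l * R y ^ 2 = 0 := by
    have := congrArg (fun t => t * R y) h0
    simp only [zero_mul] at this
    linarith [this]
  rw [h1, mul_one] at h2
  linarith

/-- **Symmetric derivative of the tangential field.** Let `U`, `R` be smooth and satisfy on the
open set `S`: Euler's relation `DU(y) y = −U(y)`, vanishing radial vorticity
`y₀(∂₁U₂ − ∂₂U₁) + y₁(∂₂U₀ − ∂₀U₂) + y₂(∂₀U₁ − ∂₁U₀) = 0`, and `R|y|² = 1`.  Then the field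
`Vᵢ = Uᵢ − ⟪y, U⟫ R yᵢ` has `∂ₗVᵢ = ∂ᵢVₗ` on `S` (Šverák: "`dv = 0`"). [cite: Sverak2011, §4 Lemma 1] -/
theorem pderiv_tangential_symm_on (hU : ContDiff ℝ ∞ U) (hR : ContDiff ℝ ∞ R) (hS : IsOpen S)
    (hEu : ∀ y ∈ S, fderiv ℝ U y y = -U y)
    (hq : ∀ y ∈ S, y 0 * (pderiv 1 (fun z => U z 2) y - pderiv 2 (fun z => U z 1) y) +
      y 1 * (pderiv 2 (fun z => U z 0) y - pderiv 0 (fun z => U z 2) y) +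
      y 2 * (pderiv 0 (fun z => U z 1) y - pderiv 1 (fun z => U z 0) y) = 0)
    (hR1 : ∀ y ∈ S, R y * ∑ i, y i ^ 2 = 1) {y : EuclideanSpace ℝ (Fin 3)} (hy : y ∈ S)
    (l i : Fin 3) :
    pderiv l (fun z => U z i - (∑ j, z j * U z j) * R z * z i) y =
      pderiv i (fun z => U z l - (∑ j, z j * U z j) * R z * z l) y := by
  have hRd : Differentiable ℝ R := hR.differentiable (by simp)
  have hFd : Differentiable ℝ fun z : EuclideanSpace ℝ (Fin 3) => ∑ j, z j * U z j :=
    differentiable_radial hU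
  have hFR : Differentiable ℝ fun z : EuclideanSpace ℝ (Fin 3) => (∑ j, z j * U z j) * R z :=
    hFd.mul hRd
  -- expand `∂ₗVᵢ`
  have hexp : ∀ l i, pderiv l (fun z => U z i - (∑ j, z j * U z j) * R z * z i) y =
      pderiv l (fun z => U z i) y -
        (((U y l + ∑ j, y j * pderiv l (fun z => U z j) y) * R y +
          (∑ j, y j * U y j) * pderiv l R y) * y i +
          (∑ j, y j * U y j) * R y * if i = l then 1 else 0) := by
    intro l i
    rw [pderiv_sub (f := fun z => U z i) (g := fun z => (∑ j, z j * U z j) * R z * z i)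
        (differentiable_comp hU i) (hFR.mul (differentiable_coord i)),
      pderiv_mul (f := fun z => (∑ j, z j * U z j) * R z) (g := fun z => z i) hFR
        (differentiable_coord i),
      pderiv_mul (f := fun z => ∑ j, z j * U z j) (g := R) hFd hRd, pderiv_radial hU]
    beta_reduce
    rw [pderiv_coord]
  rw [hexp, hexp, pderiv_invNormSq_on hR hS hR1 hy l, pderiv_invNormSq_on hR hS hR1 hy i]
  -- the algebra
  have halg := tangential_algebra (fun i => y i) (fun i => U y i)
    (fun l => U y l + ∑ j, y j * pderiv l (fun z => U z j) y)
    (fun j i => pderiv j (fun z => U z i) y) (∑ i, y i ^ 2)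
    (fun i => by
      have := sum_mul_pderiv_comp_eq ((hU.differentiable (by simp)) y)
        (k := -1) (by rw [hEu y hy, neg_one_smul]) i
      rw [this]; ring) (hq y hy) rfl (fun l => rfl) l i
  have h1 := hR1 y hy
  -- multiply the algebra identity by `R` and use `R |y|² = 1`
  have h2 : pderiv l (fun z => U z i) y - pderiv i (fun z => U z l) y =
      R y * ((U y l + ∑ j, y j * pderiv l (fun z => U z j) y) * y i -
        (U y i + ∑ j, y j * pderiv i (fun z => U z j) y) * y l) := by
    have := congrArg (fun t => R y * t) halg
    simp only at this
    rw [← mul_assoc, h1, one_mul] at this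
    exact this
  by_cases hli : i = l
  · subst hli; rfl
  · have hil : ¬l = i := fun h => hli h.symm
    simp only [hli, hil, if_false, mul_zero, add_zero]
    linarith [h2]

end Global

/-! ### The potential -/

section Potential

variable {u : EuclideanSpace ℝ (Fin 3) → EuclideanSpace ℝ (Fin 3)} {p : EuclideanSpace ℝ (Fin 3) → ℝ}

/-- The tangential part `V(x) = u(x) − (⟪x, u x⟫/|x|²) x` is smooth on `{x ≠ 0}`, orthogonal to
`x`, and `(−1)`-homogeneous when `u` is. [folklore] -/
theorem tangential_basic (hu : ContDiffOn ℝ ∞ u {x | x ≠ 0})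
    (hhom : ∀ (t : ℝ) (x : EuclideanSpace ℝ (Fin 3)), 0 < t → x ≠ 0 → t • u (t • x) = u x) :
    ContDiffOn ℝ ∞ (fun x => u x - (⟪x, u x⟫ / ‖x‖ ^ 2) • x) {x | x ≠ 0} ∧
    (∀ x : EuclideanSpace ℝ (Fin 3), x ≠ 0 → ⟪x, u x - (⟪x, u x⟫ / ‖x‖ ^ 2) • x⟫ = 0) ∧
    (∀ (t : ℝ) (x : EuclideanSpace ℝ (Fin 3)), 0 < t → x ≠ 0 →
      u (t • x) - (⟪t • x, u (t • x)⟫ / ‖t • x‖ ^ 2) • (t • x) =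
        t⁻¹ • (u x - (⟪x, u x⟫ / ‖x‖ ^ 2) • x)) := by
  refine ⟨?_, fun x hx => ?_, fun t x ht hx => ?_⟩
  · have hin : ContDiffOn ℝ ∞ (fun x => ⟪x, u x⟫) {x | x ≠ 0} := contDiffOn_id.inner ℝ hu
    have hn : ContDiffOn ℝ ∞ (fun x : EuclideanSpace ℝ (Fin 3) => ‖x‖ ^ 2) {x | x ≠ 0} :=
      (contDiff_norm_sq ℝ).contDiffOn
    exact hu.sub ((hin.div hn fun x hx => pow_ne_zero 2 (norm_ne_zero_iff.mpr hx)).smul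
      contDiffOn_id)
  · have hr : (‖x‖ ^ 2 : ℝ) ≠ 0 := pow_ne_zero 2 (norm_ne_zero_iff.mpr hx)
    rw [inner_sub_right, inner_smul_right, real_inner_self_eq_norm_sq]
    field_simp
    ring
  · have hut : u (t • x) = t⁻¹ • u x := by
      rw [← hhom t x ht hx, smul_smul, inv_mul_cancel₀ ht.ne', one_smul]
    rw [hut, inner_smul_left, inner_smul_right, norm_smul, Real.norm_of_nonneg ht.le,
      RCLike.conj_to_real, smul_sub, smul_smul, smul_smul]
    congr 1
    have hr : (‖x‖ : ℝ) ≠ 0 := norm_ne_zero_iff.mpr hx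
    congr 1
    field_simp

/-- **The tangential field is a gradient of a `0`-homogeneous potential** (Šverák 2011, §4:
"since `dv = 0` we can write `v = ∇φ`").  For the data of Theorem 1 there is `Φ : ℝ³ → ℝ`, smooth
on `{x ≠ 0}`, with `DΦ(x) = ⟪u(x) − (⟪x, u x⟫/|x|²) x, ·⟫` and `Φ(t x) = Φ(x)` (`t > 0`) there.
[cite: Sverak2011, §4] -/
theorem exists_tangential_potential (hu : ContDiffOn ℝ ∞ u {x | x ≠ 0})
    (hp : ContDiffOn ℝ ∞ p {x | x ≠ 0})
    (hns : ∀ x, x ≠ 0 → -(Δ u) x + convect u u x + gradient p x = 0)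
    (hdiv : ∀ x, x ≠ 0 → VectorCalculus.divergence u x = 0)
    (hhom : ∀ (t : ℝ) (x : EuclideanSpace ℝ (Fin 3)), 0 < t → x ≠ 0 → t • u (t • x) = u x) :
    ∃ Φ : EuclideanSpace ℝ (Fin 3) → ℝ, ContDiffOn ℝ ∞ Φ {x | x ≠ 0} ∧
      (∀ x : EuclideanSpace ℝ (Fin 3), x ≠ 0 →
        HasFDerivAt Φ (innerSL ℝ (u x - (⟪x, u x⟫ / ‖x‖ ^ 2) • x)) x) ∧
      ∀ (t : ℝ) (x : EuclideanSpace ℝ (Fin 3)), 0 < t → x ≠ 0 → Φ (t • x) = Φ x := by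
  have hΩ : IsOpen {x : EuclideanSpace ℝ (Fin 3) | x ≠ 0} := isOpen_compl_singleton
  obtain ⟨hVs, hVt, hVh⟩ := tangential_basic hu hhom
  set V : EuclideanSpace ℝ (Fin 3) → EuclideanSpace ℝ (Fin 3) :=
    fun x => u x - (⟪x, u x⟫ / ‖x‖ ^ 2) • x with hV
  -- Lemma 1: the radial vorticity vanishes
  obtain ⟨k₀, -, hq, -⟩ := bernoulliK_const_and_radVort_eq_zero hu hp hns hdiv hhom rfl rfl rfl
  -- symmetry of `DV` at every `x ≠ 0`, via regularisation around `x`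
  have hsymm : ∀ x : EuclideanSpace ℝ (Fin 3), x ≠ 0 → ∀ h k : EuclideanSpace ℝ (Fin 3),
      ⟪fderiv ℝ V x h, k⟫ = ⟪fderiv ℝ V x k, h⟫ := by
    intro x hx h k
    set δ : ℝ := ‖x‖ / 2 with hδ_def
    have hδ : 0 < δ := by have := norm_pos_iff.mpr hx; positivity
    have hxS : δ < ‖x‖ := by have := norm_pos_iff.mpr hx; rw [hδ_def]; linarith
    obtain ⟨U, hU, hUu⟩ := exists_contDiff_eq_of_contDiffOn hu hδ
    have hRo : ContDiffOn ℝ ∞ (fun y : EuclideanSpace ℝ (Fin 3) => (∑ i, y i ^ 2)⁻¹) {y | y ≠ 0} := by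
      refine (ContDiff.sum fun i _ => (contDiff_coord i).pow 2).contDiffOn.inv fun y hy => ?_
      rw [← EuclideanSpace.real_norm_sq_eq]; exact pow_ne_zero 2 (norm_ne_zero_iff.mpr hy)
    obtain ⟨R, hR, hRr⟩ := exists_contDiff_eq_of_contDiffOn hRo hδ
    have hS := isOpen_lt_norm δ
    obtain ⟨-, -, hEuU⟩ := transfer_equations (p := p) (P := p) hδ hu hns hdiv hhom hUu
      (fun _ _ => rfl)
    have huU : EqOn u U {y | δ < ‖y‖} := fun y hy => (hUu y (le_of_lt hy)).symm
    have huUi : ∀ i, EqOn (fun z => u z i) (fun z => U z i) {y | δ < ‖y‖} := fun i y hy => by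
      simp only [huU hy]
    have hR1 : ∀ y ∈ {y : EuclideanSpace ℝ (Fin 3) | δ < ‖y‖}, R y * ∑ i, y i ^ 2 = 1 := by
      intro y hy
      rw [hRr y (le_of_lt hy), inv_mul_cancel₀]
      rw [← EuclideanSpace.real_norm_sq_eq]
      exact pow_ne_zero 2 (norm_ne_zero_iff.mpr (ne_zero_of_lt_norm hδ hy))
    have hqU : ∀ y ∈ {y : EuclideanSpace ℝ (Fin 3) | δ < ‖y‖},
        y 0 * (pderiv 1 (fun z => U z 2) y - pderiv 2 (fun z => U z 1) y) +
        y 1 * (pderiv 2 (fun z => U z 0) y - pderiv 0 (fun z => U z 2) y) +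
        y 2 * (pderiv 0 (fun z => U z 1) y - pderiv 1 (fun z => U z 0) y) = 0 := by
      intro y hy
      have hy0 := ne_zero_of_lt_norm hδ hy
      have hd : DifferentiableAt ℝ u y := (hu.contDiffAt (hΩ.mem_nhds hy0)).differentiableAt (by simp)
      have := hq y hy0
      rw [inner_curl_eq hd] at this
      simpa only [pderiv_eqOn hS (huUi _) _ hy] using this
    -- the regularised tangential field agrees with `V` on `S`
    set VU : EuclideanSpace ℝ (Fin 3) → EuclideanSpace ℝ (Fin 3) :=
      fun y => U y - ((∑ j, y j * U y j) * R y) • y with hVU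
    have hVVU : EqOn V VU {y | δ < ‖y‖} := by
      intro y hy
      have e1 : ⟪y, U y⟫ = ∑ j, y j * U y j := by
        simp only [PiLp.inner_apply, RCLike.inner_apply, conj_trivial]
        exact Finset.sum_congr rfl fun j _ => mul_comm _ _
      have e2 : ‖y‖ ^ 2 = ∑ i, y i ^ 2 := EuclideanSpace.real_norm_sq_eq y
      simp only [hV, hVU, huU hy, e1, e2, hRr y (le_of_lt hy), div_eq_mul_inv]
    have hVUi : ∀ i, (fun y => VU y i) = fun z => U z i - (∑ j, z j * U z j) * R z * z i := by
      intro i; funext y; simp [hVU]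
    have hVUd : Differentiable ℝ VU := by
      rw [hVU]
      exact (hU.differentiable (by simp)).sub (((differentiable_radial hU).mul
        (hR.differentiable (by simp))).smul differentiable_id)
    -- `fderiv V x = fderiv VU x`, then compute in coordinates
    rw [(hVVU.eventuallyEq_of_mem (hS.mem_nhds hxS)).fderiv_eq]
    have hcoord : ∀ h k : EuclideanSpace ℝ (Fin 3), ⟪fderiv ℝ VU x h, k⟫ =
        ∑ i, k i * ∑ l, h l * pderiv l (fun z => U z i - (∑ j, z j * U z j) * R z * z i) x := by
      intro h k
      rw [real_inner_comm, PiLp.inner_apply]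
      refine Finset.sum_congr rfl fun i _ => ?_
      rw [RCLike.inner_apply, conj_trivial, euclidean_fderiv_apply_comp (hVUd x),
        fderiv_apply_eq_sum_mul_pderiv, hVUi i, mul_comm]
    rw [hcoord, hcoord]
    simp only [Finset.mul_sum]
    rw [Finset.sum_comm]
    refine Finset.sum_congr rfl fun i _ => Finset.sum_congr rfl fun l _ => ?_
    rw [pderiv_tangential_symm_on hU hR hS hEuU hqU hR1 hxS l i]
    ring
  -- Poincaré
  obtain ⟨Φ, hΦs, hΦ⟩ := exists_gradient_eq_of_fderiv_symmetric hVs hsymm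
  refine ⟨Φ, hΦs, hΦ, fun t x ht hx => ?_⟩
  -- `0`-homogeneity along rays: `d/ds Φ(s x) = ⟪V(s x), x⟫ = s⁻¹ ⟪s x, V(s x)⟫ = 0`
  have hsx : ∀ s : ℝ, 0 < s → s • x ≠ 0 := fun s hs => smul_ne_zero hs.ne' hx
  have hderiv : ∀ s : ℝ, 0 < s → HasDerivAt (fun s : ℝ => Φ (s • x)) 0 s := by
    intro s hs
    have h1 : HasDerivAt (fun s : ℝ => s • x) x s := by
      simpa using (hasDerivAt_id s).smul_const x
    have h2 : HasDerivAt (fun s : ℝ => Φ (s • x)) (innerSL ℝ (V (s • x)) x) s :=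
      (hΦ _ (hsx s hs)).comp_hasDerivAt s h1
    have h3 : innerSL ℝ (V (s • x)) x = 0 := by
      rw [innerSL_apply_apply]
      have := hVt _ (hsx s hs)
      rw [inner_smul_left, RCLike.conj_to_real, mul_eq_zero] at this
      rw [real_inner_comm]
      exact this.resolve_left hs.ne'
    rwa [h3] at h2
  have hconst := IsOpen.is_const_of_deriv_eq_zero (f := fun s : ℝ => Φ (s • x)) isOpen_Ioi
    isPreconnected_Ioi (fun s hs => (hderiv s hs).differentiableAt.differentiableWithinAt)
    (fun s hs => (hderiv s hs).deriv) ht (zero_lt_one' ℝ)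
  simpa using hconst

end Potential

end Sverak2011

end Literature.Analysis.FluidPDE
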